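/-
Copyright (c) 2026. All rights reserved.
Released under Apache 2.0 license as described in the file LICENSE.
Authors: abc-iut cell — seat abc-iut-w4-d089 (wave 4, gen 9; row «F-1922-AS-TYPED», L3-lead β43 (b)/(c)), after abc-iut-L3-t3
(`ArithMaximalCompact.lean`, `ArithmeticCoverings.lean`) and abc-iut-w4-d083 (`ArithQuasiGeometricCompat(Proofs).lean`).
-/
import Literature.AnabelianGeometry.SemiGraphs.ArithQuasiGeometricLiteralReduction
import HarnessLib

/-!
# [SemiAnbd] Thm 5.4 (iii) AS TYPED (F-1922): the exact NON-FOLLOWING inference as a typed statement — ONE collapsing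
# literally arithmetically quasi-geometric `f` falsifies the frozen LITERAL statement (the refutation SCHEMA; no carrier)

Mochizuki, *Semi-graphs of anabelioids*, Publ. RIMS **42** (2006), §5 Thm 5.4 (iii) p. 66 [cite: MochizukiSemiAnbd2006,
Thm 5.4 (iii), p. 66].

PROOF-ONLY file (abc-iut cell, layer L3, T54 board / L-F pack B row F-1922 «AS-TYPED», L3-lead ruling β43; seat
abc-iut-w4-d089 gen 9).  No definition, no new named fact, no instance; statement files untouched.  Sequel of
`ArithQuasiGeometricLiteralReduction.lean` (same seat: literal ⟹ compatible modulo the displayed hypothesis `hdist` — "no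
literally arithmetically quasi-geometric `f` collapses an arithmetically ample pair of distinct arithmetically maximal compact
subgroups into one").  THIS file is the other direction of the adjudication of F-1922 AS TYPED, as PURE GROUP THEORY and
WITHOUT any carrier: it isolates the exact inference of the frozen literal clause (3) that does not follow.

* `not_arithQuasiGeometricCorrespondenceStatement_of_collapse` — let the target carry decomposition data `D` with Thm 5.4
  (ii) AS TYPED (for the augmentation `e⁻¹ ∘ augH`), and let clause (1) hold in the COMPATIBLE reading for the given `B^temp`
  (as it does at the outer models: integrated line v6, p457403).  If some `f : Π^temp_𝔊 → Π^temp_ℍ` is arithmetically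
  quasi-geometric in the LITERAL sense and COLLAPSES — two distinct arithmetically maximal compact `K₁ ≠ H₁` with
  arithmetically ample meet have `f(K₁)`, `f(H₁)` contained in arithmetically maximal compact subgroups of the target ONLY
  when that subgroup is one fixed `M` — then the frozen LITERAL `ArithQuasiGeometricCorrespondenceStatement` is FALSE for
  these data.  Proof: literal clause (3) writes `f = h · B^temp(φ) · h⁻¹`; compatibility of `B^temp(φ)` gives distinct
  `A ≠ B` over `B^temp(φ)(K₁)`, `B^temp(φ)(H₁)`; their `h`-conjugates are arithmetically maximal compact (Thm 5.4 (ii):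
  verticial, closed under conjugation) and contain `f(K₁)`, `f(H₁)`, so both equal `M` — contradiction.
* `not_arithQuasiGeometricCorrespondenceStatement_of_collapse'` — the same with the uniqueness of the over-group DERIVED:
  it suffices that `f` collapses `K₁`, `H₁` into one arithmetically maximal compact `M` and that `f(K₁)`, `f(H₁)` lie in no
  EDGE-LIKE subgroup of the target (then, by `IsArithQuasiGeometric.exists_pinned_pair`, `M` is their only arithmetically
  maximal compact over-group) — the form a tempered carrier supplies (a vertex group's open image is in no edge group under
  total elevation).

So, in the kernel: at any data where v6's conclusion holds, **F-1922 AS TYPED ⟺ v6 ∧ hdist**, and a single arithmetic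
COLLAPSE FOLD refutes it.  HONEST LABEL.  No carrier is constructed here: whether a Thm-5.4-frame carrier WITH an edge
(totally arithmetically estranged, hence a NON-split outer action — abc-iut-w4-d040's `ArithTotalEstrangementOpenKernelObstruction`,
abc-iut-w6-d072's split obstruction) admits a `Π_A`-equivariant collapse fold (the outer-model lift of abc-iut-L3-t12's geometric
`IwahoriWitness.exists_collapseFold`) is the cell's open NV obligation of record (GAP-LEDGER row G-w4d089-g9-1); until then
F-1922's literal clause (3) is CONDITIONAL (on `hdist`), not refuted.  Typed ≠ proved; nothing here bears on [IUTchIII]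
Cor. 3.12.
-/

namespace Literature.AnabelianGeometry.SemiGraphs

universe u v w uG uH uV uB

section Thm54iii

variable {Obj : Type u} [CategoryTheory.Category.{v} Obj] {𝓥 : SemiAnbdVocab.{u, v, w} Obj}
variable {𝔊 ℍ : ArithSemiGraph 𝓥} {e : 𝔊.PA ≃* ℍ.PA}
variable {Gtp : Type uG} [Group Gtp] [TopologicalSpace Gtp]
variable {Htp : Type uH} [Group Htp] [TopologicalSpace Htp]
variable {V : Type uV} {B : Type uB}

omit [TopologicalSpace Gtp] [TopologicalSpace Htp] in
/-- If `f = h · g(·) · h⁻¹` pointwise, the image of a subgroup under `f` is the `h`-conjugate of its image under `g`.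
[folklore] -/
private theorem map_eq_conjSubgroup_map_of_eq_conj {f g : Gtp →* Htp} {h : Htp} (hfg : ∀ x, f x = h * g x * h⁻¹)
    (K : Subgroup Gtp) : K.map f = conjSubgroup h (K.map g) := by
  simp only [conjSubgroup, Subgroup.map_map]
  congr 1
  ext x
  simp [MulAut.conj_apply, hfg x]

omit [TopologicalSpace Gtp] in
/-- Under Thm 5.4 (ii) AS TYPED, arithmetically maximal compact subgroups (= verticial subgroups) are closed under
conjugation. [cite: MochizukiSemiAnbd2006, Thm 5.4 (ii), p. 66] -/
theorem ArithMaximalCompactStatementII.isArithMaximalCompact_conjSubgroup {PA : Type*} [Group PA] [TopologicalSpace PA]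
    {D : DecompositionData Htp V B} {aug : Htp →* PA} (hII : ArithMaximalCompactStatementII D aug) {A : Subgroup Htp}
    (hA : IsArithMaximalCompact aug A) (h : Htp) : IsArithMaximalCompact aug (conjSubgroup h A) :=
  (hII.1 _).2 (((hII.1 A).1 hA).conj h)

/-- **The exact non-following inference of F-1922 AS TYPED, as a typed statement (refutation SCHEMA, no carrier).**  Let
Thm 5.4 (ii) hold AS TYPED on the target (augmentation `e⁻¹ ∘ augH`) and let clause (1) hold in the COMPATIBLE reading for
`B^temp` (as at the outer models, v6).  If a LITERALLY arithmetically quasi-geometric `f` over `A^⊤` COLLAPSES an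
arithmetically ample pair — `K₁ ≠ H₁` arithmetically maximal compact with arithmetically ample meet, and one arithmetically
maximal compact `M` of the target is the ONLY arithmetically maximal compact subgroup containing `f(K₁)` and the only one
containing `f(H₁)` — then the frozen LITERAL `ArithQuasiGeometricCorrespondenceStatement` fails for these data: clause (3)
would make `f` an inner conjugate of a COMPATIBLY quasi-geometric `B^temp(φ)`, whose distinct targets `A ≠ B` conjugate to
two distinct arithmetically maximal compact over-groups of `f(K₁)`, `f(H₁)`. [cite: MochizukiSemiAnbd2006, Thm 5.4 (iii), p. 66] -/
theorem not_arithQuasiGeometricCorrespondenceStatement_of_collapse {augG : Gtp →* 𝔊.PA} {augH : Htp →* ℍ.PA}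
    {btemp : (φ : ArithHom 𝓥 𝔊 ℍ) → φ.IsLocallyOpen → ArithHom.IsOverA 𝔊 ℍ e φ → (Gtp →* Htp)}
    (D : DecompositionData Htp V B) (hII : ArithMaximalCompactStatementII D (e.symm.toMonoidHom.comp augH))
    (h1c : ∀ (φ : ArithHom 𝓥 𝔊 ℍ) (h₁ : φ.IsLocallyOpen) (h₂ : ArithHom.IsOverA 𝔊 ℍ e φ),
      IsArithCompatiblyQuasiGeometric augG (e.symm.toMonoidHom.comp augH) (btemp φ h₁ h₂))
    {f : Gtp →* Htp} (hf : IsArithQuasiGeometric augG (e.symm.toMonoidHom.comp augH) f)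
    {K₁ H₁ : Subgroup Gtp} (hK₁ : IsArithMaximalCompact augG K₁) (hH₁ : IsArithMaximalCompact augG H₁) (hne : K₁ ≠ H₁)
    (ha : IsArithAmple augG (K₁ ⊓ H₁)) {M : Subgroup Htp}
    (huK : ∀ A : Subgroup Htp, IsArithMaximalCompact (e.symm.toMonoidHom.comp augH) A → K₁.map f ≤ A → A = M)
    (huH : ∀ A : Subgroup Htp, IsArithMaximalCompact (e.symm.toMonoidHom.comp augH) A → H₁.map f ≤ A → A = M) :
    ¬ ArithQuasiGeometricCorrespondenceStatement 𝔊 ℍ e augG augH btemp := by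
  intro hS
  obtain ⟨φ, h₁, h₂, h, hfeq⟩ := hS.2.2 f hf
  obtain ⟨A, B', hA, hB, hAB, hKA, hHB⟩ := (h1c φ h₁ h₂).2 K₁ H₁ hK₁ hH₁ hne ha
  have hKA' : K₁.map f ≤ conjSubgroup h A := by
    rw [map_eq_conjSubgroup_map_of_eq_conj hfeq]
    exact Subgroup.map_mono hKA
  have hHB' : H₁.map f ≤ conjSubgroup h B' := by
    rw [map_eq_conjSubgroup_map_of_eq_conj hfeq]
    exact Subgroup.map_mono hHB
  have hA' := huK _ (hII.isArithMaximalCompact_conjSubgroup hA h) hKA'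
  have hB'' := huH _ (hII.isArithMaximalCompact_conjSubgroup hB h) hHB'
  have hinj : Function.Injective (MulAut.conj h).toMonoidHom := (MulAut.conj h).injective
  refine hAB (Subgroup.map_injective hinj ?_)
  change conjSubgroup h A = conjSubgroup h B'
  rw [hA', hB'']

/-- **The same, with the uniqueness of the over-group DERIVED** (the form a tempered carrier supplies): under Thm 5.4 (i) ∧
(ii) AS TYPED on the target and compatible clause (1) for `B^temp`, a LITERALLY arithmetically quasi-geometric `f` that
carries `K₁ ≠ H₁` (arithmetically maximal compact, arithmetically ample meet, Hausdorff source) into ONE arithmetically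
maximal compact `M`, with `f(K₁)` and `f(H₁)` contained in NO edge-like subgroup of the target, falsifies the frozen
LITERAL `ArithQuasiGeometricCorrespondenceStatement`.  (By `IsArithQuasiGeometric.exists_pinned_pair` every arithmetically
maximal compact over-group of `f(K₁)` or `f(H₁)` is `K₂` or `H₂` for one edge-like `K₂ ∩ H₂`; lying in both would put the
image inside that edge-like subgroup.) [cite: MochizukiSemiAnbd2006, Thm 5.4 (iii), p. 66] -/
theorem not_arithQuasiGeometricCorrespondenceStatement_of_collapse' [T2Space Gtp] {augG : Gtp →* 𝔊.PA}
    {augH : Htp →* ℍ.PA} {btemp : (φ : ArithHom 𝓥 𝔊 ℍ) → φ.IsLocallyOpen → ArithHom.IsOverA 𝔊 ℍ e φ → (Gtp →* Htp)}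
    (D : DecompositionData Htp V B) (hI : ArithMaximalCompactStatementI D (e.symm.toMonoidHom.comp augH))
    (hII : ArithMaximalCompactStatementII D (e.symm.toMonoidHom.comp augH))
    (h1c : ∀ (φ : ArithHom 𝓥 𝔊 ℍ) (h₁ : φ.IsLocallyOpen) (h₂ : ArithHom.IsOverA 𝔊 ℍ e φ),
      IsArithCompatiblyQuasiGeometric augG (e.symm.toMonoidHom.comp augH) (btemp φ h₁ h₂))
    {f : Gtp →* Htp} (hf : IsArithQuasiGeometric augG (e.symm.toMonoidHom.comp augH) f)
    {K₁ H₁ : Subgroup Gtp} (hK₁ : IsArithMaximalCompact augG K₁) (hH₁ : IsArithMaximalCompact augG H₁) (hne : K₁ ≠ H₁)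
    (ha : IsArithAmple augG (K₁ ⊓ H₁)) {M : Subgroup Htp} (hM : IsArithMaximalCompact (e.symm.toMonoidHom.comp augH) M)
    (hKM : K₁.map f ≤ M) (hHM : H₁.map f ≤ M)
    (hKE : ∀ E : Subgroup Htp, IsEdgeLike D E → ¬ K₁.map f ≤ E) (hHE : ∀ E : Subgroup Htp, IsEdgeLike D E → ¬ H₁.map f ≤ E) :
    ¬ ArithQuasiGeometricCorrespondenceStatement 𝔊 ℍ e augG augH btemp := by
  obtain ⟨K₂, H₂, -, -, -, -, hE, -, -, -, hM'⟩ := hf.exists_pinned_pair hI hII hK₁ hH₁ hne ha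
  have hMM := hM' M hM ((Subgroup.map_mono inf_le_left).trans hKM)
  -- `M` is the only arithmetically maximal compact over-group of `f(K₁)` and of `f(H₁)`
  have huniq : ∀ (X : Subgroup Gtp), X.map f ≤ M → (K₁ ⊓ H₁).map f ≤ X.map f → (∀ E, IsEdgeLike D E → ¬ X.map f ≤ E) →
      ∀ A : Subgroup Htp, IsArithMaximalCompact (e.symm.toMonoidHom.comp augH) A → X.map f ≤ A → A = M := by
    intro X hXM hLX hXE A hA hXA
    have hAA := hM' A hA (hLX.trans hXA)
    by_contra hAM
    have hne₂ : (A = K₂ ∧ M = H₂) ∨ (A = H₂ ∧ M = K₂) := by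
      rcases hAA with rfl | rfl <;> rcases hMM with rfl | rfl
      exacts [(hAM rfl).elim, Or.inl ⟨rfl, rfl⟩, Or.inr ⟨rfl, rfl⟩, (hAM rfl).elim]
    refine hXE (K₂ ⊓ H₂) hE ?_
    rcases hne₂ with ⟨rfl, rfl⟩ | ⟨rfl, rfl⟩
    exacts [le_inf hXA hXM, le_inf hXM hXA]
  exact not_arithQuasiGeometricCorrespondenceStatement_of_collapse D hII h1c hf hK₁ hH₁ hne ha
    (huniq K₁ hKM (Subgroup.map_mono inf_le_left) hKE) (huniq H₁ hHM (Subgroup.map_mono inf_le_right) hHE)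

end Thm54iii

end Literature.AnabelianGeometry.SemiGraphs
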